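import Literature.NumberTheory.GelbartRogawski1991.LocalDoubledUnitaryUnramifiedParabolic
import Literature.NumberTheory.GelbartRogawski1991.LocalUnitaryIntegralLattice
import Literature.NumberTheory.GelbartRogawski1991.LocalDoubledUnitaryDatum
import Literature.NumberTheory.GelbartRogawski1991.LocalUnitarySplitPlaceLagrangian
import Literature.NumberTheory.Weil1964.LocalLerayCocycleStabiliser
import Literature.NumberTheory.Weil1964.LocalLerayCocycleParabolic
import Literature.NumberTheory.Automorphic.UnitaryGroupSplitPlace
import Literature.NumberTheory.QuadraticForms.HilbertSymbol
import Literature.LinearAlgebra.QuadraticForm.LagrangianTransitive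
import Literature.GroupTheory.GroupChunkExtension
import Literature.NumberTheory.GelbartRogawski1991.LocalDoubledUnitarySplitParabolic
import Literature.NumberTheory.GelbartRogawski1991.LocalLeraySection
import Literature.NumberTheory.GelbartRogawski1991.LocalLeraySectionSmooth
import Literature.NumberTheory.GelbartRogawski1991.LocalDoubledUnitaryGoodPlace
import Literature.NumberTheory.GelbartRogawski1991.LocalDoubledUnitaryDeltaIsometry
import Literature.NumberTheory.GelbartRogawski1991.LocalDoubledUnitaryParabolicNorm
import Literature.NumberTheory.GelbartRogawski1991.CMSplittingCharLocalComponents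
import Literature.NumberTheory.GelbartRogawski1991.RationalSymplecticUnramifiedVector
import Literature.RepresentationTheory.HeisenbergGroup.LeraySectionUnramifiedParabolic
import HarnessLib

-- buildfix G11b-3 recipe (LEDGER B13-1/B13-3): elaborate sequentially so the trailing `attribute [implicit_reducible]`
-- block (reducibilityCoreExt is keyed to the async environment branch) is in force at `.olean` export.
set_option Elab.async false

/-!
# The non-archimedean local splitting data of the doubled unitary group `H = U(𝕍 ⊕ −𝕍)`, 0: preliminaries
# ([Rangarao1993, Thm 4.1]; [Weil1964, n° 32]; [Kudla1994, Thm 3.1]; [MoeglinVignerasWaldspurger1987, Chap. 2 II.8])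

Topic `NumberTheory/GelbartRogawski1991`; namespace
`Literature.NumberTheory.GelbartRogawski1991.UnitaryDualPair.LocalSplitting`. KERNEL construction: every `def` has
a body, every theorem is proved (no named fact, no `sorry`).

The place-by-place ingredients shared by the non-split and the split halves of the local splitting data of the doubled
unitary group (sequels `LocalDoubledUnitarySplittingData`, `LocalDoubledUnitarySplittingDataSplit`,
`LocalDoubledUnitarySplittingDataCM`).  Setting as in `LocalDoubledUnitaryDatum`: `E/F` quadratic with automorphism
`c`, `δ ∈ E` with `c δ = -δ ≠ 0`, `d = δ²`, a finite place `v` of `F` with a Haar measure `μ` on `F_v`, a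
non-degenerate symmetric `T₀ ∈ M_n(F)`, the doubled space `𝔻 = 𝕍 ⊕ (−𝕍)` with Gram matrix `gramD F n T₀`, its unitary
group `H(F_v) = UnitaryGroup.localPi E c (n+n) JD v`, `ι = iotaD : H(F_v) → Sp(𝕎_v)` and `ℓ_Δ = deltaLagrangian F v n`.

* L0 `LeraySectionDatum`, `leraySectionDatum`, `L0D`: Rao's Leray-normalised implementer section of the local
  Schrödinger model at the character `ψ_v(½·)` (tree `exists_leraySection_half`), whose multiplier is EXACTLY the
  Leray cocycle.
* L1s `L1s_splitStableLagrangian`, `betaSplit` (+ `betaSplit_one`, `betaSplit_mul`, `betaSplit_eq_one_of_map_eq`): at a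
  SPLIT place `ι(H(F_v))` fixes a Lagrangian, so the stabiliser principle (`Weil1964/LocalLerayCocycleStabiliser`)
  gives a splitting function outright.
* the hypotheses on the local characters: `IsEpsilonChar` (`χ_w|_{F_vˣ} = (d, ·)_v` at a non-split place) and
  `IsTrivialNearOne` (`χ_w` trivial near `1`).
* L6a `L6a_parabolicSmooth`: parabolic smoothness of the Leray-normalised section along `ι(P_Δ)` (tree
  `LocalLeraySectionSmooth`).

Written for the kernel construction of [GelbartRogawski1991, Prop. 3.1.1] behind the cited input `hGRU` of the
Hodge-CM period-theorem package (stage-1 cell `pub-hodgecm`, seat GR-1 `own-real34`, gens 2–5, 2026-08-21).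
Nothing in this file is a claim of the manuscripts adjudicated by that cell.

## References

* R. Ranga Rao, *On some explicit formulas in the theory of Weil representation*, Pacific J. Math. 157 (1993), Thm 4.1
  [Rangarao1993].
* A. Weil, *Sur certains groupes d'opérateurs unitaires*, Acta Math. 111 (1964), n° 32 [Weil1964].
* S. S. Kudla, *Splitting metaplectic covers of dual reductive pairs*, Israel J. Math. 87 (1994) 361–401, §3, Thm 3.1
  [Kudla1994].
* M. Harris, S. S. Kudla, W. J. Sweet, *Theta dichotomy for unitary groups*, J. Amer. Math. Soc. 9 (1996) 941–1004,
  §1 (1.15) [HarrisKudlaSweet1996].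
* C. Mœglin, M.-F. Vignéras, J.-L. Waldspurger, *Correspondances de Howe sur un corps p-adique*, LNM 1291 (1987),
  Chap. 2 II.8 [MoeglinVignerasWaldspurger1987].
* S. Gelbart, J. Rogawski, *L-functions and Fourier–Jacobi coefficients for the unitary group U(3)*, Invent. Math. 105
  (1991), §3.1 Prop. 3.1.1 [GelbartRogawski1991].
-/

set_option autoImplicit false

noncomputable section

open NumberField IsDedekindDomain MeasureTheory Matrix
open Literature.RepresentationTheory.HeisenbergGroup
open Literature.NumberTheory.Automorphic Literature.NumberTheory.Automorphic.UnitaryGroup Literature.NumberTheory.Weil1964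
open Literature.NumberTheory.GaloisRepresentations.IsNonarchimedeanLocalField
open Literature.GroupTheory Literature.LinearAlgebra.QuadraticForm

namespace Literature.NumberTheory.GelbartRogawski1991.UnitaryDualPair.LocalSplitting

variable (F : Type) [Field F] [NumberField F] (E : Type) [Field E] [NumberField E] [Algebra F E]
  [Algebra.IsQuadraticExtension F E] (c : E ≃ₐ[F] E)
  {δ : E} (hcδ : c δ = -δ) (hδ : δ ≠ 0) {d : F} (hd : δ * δ = algebraMap F E d)
  (v : HeightOneSpectrum (𝓞 F))
  [MeasurableSpace (v.adicCompletion F)] [BorelSpace (v.adicCompletion F)]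
  (μ : Measure (v.adicCompletion F)) [μ.IsAddHaarMeasure]

local notation "Kv" => HeightOneSpectrum.adicCompletion F v

/-! ## L0 — the Leray-normalised section of the local Schrödinger model -/

section L0

-- NB: no local notation inside `variable` binders (Lean re-elaborates them per declaration and a `local
-- notation` there silently degrades to `sorry`).
variable (N : ℕ) (T : Matrix (Fin N) (Fin N) F) (hTd : IsUnit T.det)
  (ℓ : Submodule (v.adicCompletion F) ((Fin N → v.adicCompletion F) × (Fin N → v.adicCompletion F)))
  (hℓ : LinearMap.BilinForm.orthogonal (alt (polar (localPairing F N T v))) ℓ = ℓ)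

/-- **the L0 datum**: uniqueness of implementers up to scalars on the local smooth Schrödinger model, a normalised
implementer section `r`, and a continuous non-trivial character `ψ'` of `F_v` such that the multiplier of `r` is
EXACTLY the Leray cocycle `c^{ψ'}_ℓ` (Rao: `ψ' = ψ_v(½·)`). [Rangarao1993, Thm 4.1 (5)] [cite: Rangarao1993, Thm 4.1 (5), p. 358] -/
structure LeraySectionDatum where
  /-- implementers are unique up to scalars -/
  hU : ImplementerUniqueUpToScalar (localSchrodinger F N T v)
  /-- the normalised section -/
  r : ImplementerSection (localSchrodinger F N T v)
  /-- the character at which `r` is Leray-normalised -/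
  ψ' : AddChar Kv Circle
  /-- … continuous and non-trivial -/
  hψ' : ψ'.IsContinuousNontrivial
  /-- the multiplier of `r` is `c^{ψ'}_ℓ` -/
  cocycle_eq : ∀ g₁ g₂ : LocalSp F N T v, r.cocycle hU g₁ g₂ = localLeray F N T hTd v μ ψ' hψ' ℓ hℓ g₁ g₂

/-- **L0 — the Leray-normalised section exists** (tree `exists_leraySection_half`): a normalised implementer section `r`
of `localSchrodinger F N T v` with multiplier the Leray cocycle `c^{ψ_v(½·)}_ℓ`. [cite: Rangarao1993, Thm 4.1 (5), p. 358] -/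
theorem L0_leraySection : Nonempty (LeraySectionDatum F v μ N T hTd ℓ hℓ) := by
  obtain ⟨hU, r, ψ', hψ', h⟩ := exists_leraySection F N T hTd v μ ℓ hℓ
  exact ⟨⟨hU, r, ψ', hψ', h⟩⟩

/-- THE L0 datum used below: Rao's section AT THE CHARACTER `ψ' = ψ_v(½·)` (`exists_leraySection_half`; the character is
pinned — `(leraySectionDatum …).ψ' = (adeleAddCharAt F v).mulShift ⅟2` by `rfl` — because the parabolic smoothness
L6a is delivered at that character). [cite: Rangarao1993, Thm 4.1 (5), p. 358] -/
def leraySectionDatum : LeraySectionDatum F v μ N T hTd ℓ hℓ :=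
  ⟨(exists_leraySection_half F N T hTd v μ ℓ hℓ).choose, (exists_leraySection_half F N T hTd v μ ℓ hℓ).choose_spec.choose,
    (adeleAddCharAt F v).mulShift (⅟(2 : Kv)), isContinuousNontrivial_adeleAddCharAt_half F v,
    (exists_leraySection_half F N T hTd v μ ℓ hℓ).choose_spec.choose_spec⟩

/-- the character of the L0 datum is `ψ_v(½·)` (definitional). [cite: Rangarao1993, Thm 4.1 (5), p. 358] -/
theorem leraySectionDatum_ψ' : (leraySectionDatum F v μ N T hTd ℓ hℓ).ψ' = (adeleAddCharAt F v).mulShift (⅟(2 : Kv)) := rfl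

end L0

/-! ## L1s — SPLIT PLACES: `ι(U(J)(F_v))` fixes a Lagrangian, so L1 gives `β_v` outright (any character `ψ'`) -/

section Split

variable (N : ℕ) (T : Matrix (Fin N) (Fin N) F) (hT : T.IsSymm) (hTd : IsUnit T.det)
  {J : Matrix (Fin N) (Fin N) E} (hJ : J = T.map (algebraMap F E))

omit [MeasurableSpace (HeightOneSpectrum.adicCompletion F v)] [BorelSpace (HeightOneSpectrum.adicCompletion F v)] in
include hTd in
/-- **L1s (tree `LocalUnitarySplitPlaceLagrangian`)**: at a SPLIT place (`w ∣ v` with `c • w ≠ w`)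
the image `ι(U(J)(F_v)) ⊂ Sp(𝕎_v)` fixes a Lagrangian `m` of `𝕎_v` (tree `exists_stable_lagrangian_of_split`). KERNEL. [cite: Kudla1994, Thm 3.1] -/
theorem L1s_splitStableLagrangian (w : PlacesOver E v) (hw : c • w.1 ≠ w.1) :
    ∃ m : Submodule Kv ((Fin N → Kv) × (Fin N → Kv)),
      LinearMap.BilinForm.orthogonal (alt (polar (localPairing F N T v))) m = m ∧
        ∀ g : UnitaryGroup.localPi E c N J v, m.map (toLin F v (iota F E c N hcδ hδ hd T hT hJ v g)) = m :=
  exists_stable_lagrangian_of_split F E c N hcδ hδ hd hJ v hT hTd w hw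

/-- **`β_v` at a split place, at the character `ψ'`**: `β(g) := λ_m(ι g) = μ_{ψ'}(ℓ, (ι g)ℓ, m)` for the stable
Lagrangian `m` of L1s. [cite: Kudla1994, Thm 3.1] -/
def betaSplit {ψ' : AddChar Kv Circle} (hψ' : ψ'.IsContinuousNontrivial)
    (ℓ : Submodule Kv ((Fin N → Kv) × (Fin N → Kv)))
    (w : PlacesOver E v) (hw : c • w.1 ≠ w.1) (g : UnitaryGroup.localPi E c N J v) : ℂˣ :=
  stabiliserUnit μ hψ' (alt (polar (localPairing F N T v))) ℓ
    (L1s_splitStableLagrangian F E c hcδ hδ hd v N T hT hTd hJ w hw).choose (iota F E c N hcδ hδ hd T hT hJ v g)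

/-- `β(1) = 1` at a split place (`μ(ℓ, ℓ, m) = 1`). KERNEL. [cite: Kudla1994, Thm 3.1] -/
theorem betaSplit_one {ψ' : AddChar Kv Circle} (hψ' : ψ'.IsContinuousNontrivial)
    {ℓ : Submodule Kv ((Fin N → Kv) × (Fin N → Kv))}
    (hℓ : LinearMap.BilinForm.orthogonal (alt (polar (localPairing F N T v))) ℓ = ℓ)
    (w : PlacesOver E v) (hw : c • w.1 ≠ w.1) :
    betaSplit F E c hcδ hδ hd v μ N T hT hTd hJ hψ' ℓ w hw 1 = 1 := by
  ext
  rw [betaSplit, coe_stabiliserUnit, map_one, Units.val_one]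
  exact stabiliserFun_one μ hψ' _ hℓ _

/-- **`∂β = c^{ψ'}_ℓ ∘ ι` at a split place** — the stabiliser principle L1 (`lerayCentralCocycle_stabiliser`)
applied to the stable Lagrangian of L1s.  KERNEL. [cite: Kudla1994, Thm 3.1] -/
theorem betaSplit_mul {ψ' : AddChar Kv Circle} (hψ' : ψ'.IsContinuousNontrivial)
    {ℓ : Submodule Kv ((Fin N → Kv) × (Fin N → Kv))}
    (hℓ : LinearMap.BilinForm.orthogonal (alt (polar (localPairing F N T v))) ℓ = ℓ)
    (w : PlacesOver E v) (hw : c • w.1 ≠ w.1) (g₁ g₂ : UnitaryGroup.localPi E c N J v) :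
    betaSplit F E c hcδ hδ hd v μ N T hT hTd hJ hψ' ℓ w hw (g₁ * g₂) *
        localLeray F N T hTd v μ ψ' hψ' ℓ hℓ (iota F E c N hcδ hδ hd T hT hJ v g₁) (iota F E c N hcδ hδ hd T hT hJ v g₂) =
      betaSplit F E c hcδ hδ hd v μ N T hT hTd hJ hψ' ℓ w hw g₁ * betaSplit F E c hcδ hδ hd v μ N T hT hTd hJ hψ' ℓ w hw g₂ := by
  have hm := (L1s_splitStableLagrangian F E c hcδ hδ hd v N T hT hTd hJ w hw).choose_spec
  rw [betaSplit, betaSplit, betaSplit, (iota F E c N hcδ hδ hd T hT hJ v).map_mul, mul_comm]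
  exact lerayCentralCocycle_stabiliser μ hψ' (isAlt_alt_polar F N T v) (nondegenerate_alt_polar F N T v hTd) hℓ hm.1
    _ _ (hm.2 g₁)

/-- `β(p) = μ(ℓ, ℓ, m) = 1` at a split place for `p` stabilising `ℓ`. KERNEL. [cite: Kudla1994, Thm 3.1] -/
theorem betaSplit_eq_one_of_map_eq {ψ' : AddChar Kv Circle} (hψ' : ψ'.IsContinuousNontrivial)
    {ℓ : Submodule Kv ((Fin N → Kv) × (Fin N → Kv))}
    (hℓ : LinearMap.BilinForm.orthogonal (alt (polar (localPairing F N T v))) ℓ = ℓ)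
    (w : PlacesOver E v) (hw : c • w.1 ≠ w.1) (g : UnitaryGroup.localPi E c N J v)
    (hg : ℓ.map (toLin F v (iota F E c N hcδ hδ hd T hT hJ v g)) = ℓ) :
    betaSplit F E c hcδ hδ hd v μ N T hT hTd hJ hψ' ℓ w hw g = 1 := by
  ext
  rw [betaSplit, coe_stabiliserUnit, Units.val_one, stabiliserFun_def]
  change lerayWeilIndex ψ' μ _ ℓ (ℓ.map (toLin F v (iota F E c N hcδ hδ hd T hT hJ v g))) _ = 1
  rw [hg]
  exact lerayWeilIndex_self₁₂ μ hψ' _ (isotropic_of_orthogonal_eq_self hℓ) _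

end Split

/-! ## The doubled group: hypotheses on the local characters, parabolic smoothness, the L0 datum at `ℓ_Δ` -/

section Doubled

variable (n : ℕ) {T₀ : Matrix (Fin n) (Fin n) F} (hT₀ : T₀.IsSymm) (hT₀d : IsUnit T₀.det)
  {JD : Matrix (Fin (n + n)) (Fin (n + n)) E} (hJD : JD = (gramD F n T₀).map (algebraMap F E))

/-- **the hypothesis on the local character** `χ_w : E_wˣ →* ℂˣ` at a non-split place: its restriction to `F_vˣ`
(along the tree's `toPlace v w : F_v →+* E_w`) is the quadratic character `a ↦ (d, a)_v` of `E_w/F_v` (the local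
component of `χ|_{𝕀_F} = ε_{E/F}`). [cite: Kudla1994, Thm 3.1; HarrisKudlaSweet1996, §1 (1.15)] -/
def IsEpsilonChar (d₀ : F) (w : PlacesOver E v) (χw : (w.1.adicCompletion E)ˣ →* ℂˣ) : Prop :=
  ∀ a : Kvˣ, ((χw (Units.map (toPlace v w : Kv →* w.1.adicCompletion E) a) : ℂˣ) : ℂ) =
    Literature.NumberTheory.QuadraticForms.hilbertSymbol Kv (d₀ : Kv) (a : Kv)

/-- **L6a (tree `LocalLeraySectionSmooth`) — PARABOLIC
SMOOTHNESS OF THE LERAY-NORMALISED SECTION along `ι(P_Δ)`**: for every `Φ` there is a congruence level `γ < 1` at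
the place `w ∣ v` such that `r(ι p) Φ = Φ` for all `p ∈ P_Δ(F_v)` whose `w`-component lies in the principal
congruence subgroup `K_γ ≤ GL_{n+n}(E_w)` (tree `congruenceGL`).  Route: an explicit
`δ ∈ Sp(𝕎^𝔻_v)` with `δ ℓ_Y = ℓ_Δ`; by rigidity (`ImplementerSectionRigidity`) and `leraySection_apply_conj`,
`r(ι p) = r_Y(δ) · leviOpPi a(p) · unipOpPi c(p) · r_Y(δ)⁻¹` with `δ⁻¹ ι(p) δ = m(a(p)) n(c(p)) ∈ P_{ℓ_Y}`; then
`exists_box_levi_unip_eq_self` (`SchrodingerPiOperatorsSmooth`, MVW Chap. 2 II.6∕II.8) for `Ψ = r_Y(δ)⁻¹ Φ`, the box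
conditions on `(a(p), c(p))` following from `p_w ∈ K_γ` for `γ` small. Any `r` with the stated multiplier is THE
Leray section (rigidity), so the statement is about `r` abstractly. [cite: MoeglinVignerasWaldspurger1987, Chap. 2 II.8] -/
theorem L6a_parabolicSmooth (w : PlacesOver E v)
    (hU : ImplementerUniqueUpToScalar (localSchrodinger F (n + n) (gramD F n T₀) v))
    (r : ImplementerSection (localSchrodinger F (n + n) (gramD F n T₀) v))
    (hr : ∀ g₁ g₂ : LocalSp F (n + n) (gramD F n T₀) v, r.cocycle hU g₁ g₂ =
      localLeray F (n + n) (gramD F n T₀) (isUnit_det_gramD F n hT₀d) v μ ((adeleAddCharAt F v).mulShift (⅟(2 : Kv)))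
        (isContinuousNontrivial_adeleAddCharAt_half F v) (deltaLagrangian F v n) (deltaLagrangian_orthogonal F v n T₀ hT₀d) g₁ g₂)
    (Φ : SchwartzBruhat (Fin (n + n) → Kv)) :
    ∃ γ : ValuativeRel.ValueGroupWithZero (w.1.adicCompletion E), γ ≠ 0 ∧
      ∀ p : UnitaryGroup.localPi E c (n + n) JD v, IsSiegelDelta F E c hcδ hδ hd v n hT₀ hJD p →
        ((p : UnitaryGroup.LocalGLPi E (n + n) v) w ∈ congruenceGL (n + n) γ) →
        r (iotaD F E c hcδ hδ hd v n hT₀ hJD p) Φ = Φ :=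
  exists_congruenceGL_forall_siegelDelta_apply_eq_self F E c hcδ hδ hd v μ n hT₀ hT₀d hJD w hU r hr Φ

/-- **`χ_w` is trivial near `1`** (true for every continuous character of `E_wˣ`, in particular for the components
of a Hecke character): the hypothesis under which `χ_v(det_Δ p) = 1` for `p ∈ P_Δ` close to `1`. [cite: MoeglinVignerasWaldspurger1987, Chap. 2 II.8] -/
def IsTrivialNearOne (w : PlacesOver E v) (χw : (w.1.adicCompletion E)ˣ →* ℂˣ) : Prop :=
  ∀ᶠ x in nhds (1 : w.1.adicCompletion E), ∀ hx : IsUnit x, χw hx.unit = 1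

/-- the L0 datum of the doubled space at `ℓ_Δ` (a choice). [cite: Rangarao1993, Thm 4.1 (5), p. 358] -/
def L0D : LeraySectionDatum F v μ (n + n) (gramD F n T₀) (isUnit_det_gramD F n hT₀d) (deltaLagrangian F v n)
    (deltaLagrangian_orthogonal F v n T₀ hT₀d) :=
  leraySectionDatum F v μ (n + n) (gramD F n T₀) (isUnit_det_gramD F n hT₀d) (deltaLagrangian F v n)
    (deltaLagrangian_orthogonal F v n T₀ hT₀d)

end Doubled

/-! ### Build-lane note (ops-buildfix G11b-3 recipe, LEDGER B13-1, 2026-08-21)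
`lean -o` (the hub build lane, never `lean`/the gate check) runs Lean 4.32's library-suggestion indexers
(`Lean.LibrarySuggestions.SymbolFrequency` / `SineQuaNon`, from their `exportEntriesFn`) over the statement of
every local theorem that is not a denied premise; on this family's statements (very large dependent binder
telescopes through the theta-kernel / dual-pair data) that fold runs for tens of minutes to hours and the build
lane kills the job (incident G11b-3, run/shared/lean/ops/buildfix/G11b-3-DOSSIER.md). `isDeniedPremise` skips
`[implicit_reducible]` constants before any fold, and a reducibility status on a *theorem* is inert (Meta never
unfolds `thmInfo`; the kernel ignores the attribute), so the public theorems of this file are tagged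
`[implicit_reducible]` purely to keep them out of that index. Only other effect: they are not offered by
`+suggestions` premise selectors. No statement or proof is changed; superseded if the operator lands a
deny-list form (`HarnessLib.PremiseIndex`). -/
set_option allowUnsafeReducibility true in
attribute [implicit_reducible]
  L0_leraySection leraySectionDatum_ψ' L1s_splitStableLagrangian betaSplit_one betaSplit_mul
  betaSplit_eq_one_of_map_eq L6a_parabolicSmooth

end Literature.NumberTheory.GelbartRogawski1991.UnitaryDualPair.LocalSplitting

end
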